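import Summits.Parity.GeneralizedHardyLittlewood.Theorems.PrimeLevelFamEdgeMomentsBeyondDiagonalDiagGenericRemMonomial
import HarnessLib

/-!
# Route `PrimeLevelFamEdge`, crux K_A `MomentsBeyondDiagonal` (stmt-Parity-20007), line «petersson_layers» v4, stub `stub_diag`:
# **closure of the remainder FAMILY BOUND `∀ i j ≥ 1, |Σ a(k₁)a(k₂)ℓ⁺ⁱℓ⁺ʲ·G(k₁,k₂)| ≤ logⁱ⁺ʲY·Ψ` under powers of `L = 2β+ℓ⁺₁+ℓ⁺₂`
# and under finite linear combinations of kernels** (brick (R2a) of the generic remainder estimate (R_ij))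

Census `Cruxes/MomentsBeyondDiagonal/Lines/petersson_layers_stub_diag_g19_generic_assembly.md`, blueprint item (R2). The generic remainder
weight of order `(i,j)` (hypothesis of `…DiagGenericAssembly.subDiag_of_genericRemainder`) is, pointwise, a finite linear combination
`Σ_{(a,b,r,s,t)} coef · m_t(k₁)m_{t′}(k₂)·L^p·r_{ab}(αk₁k₂)` of decorated kernels times powers of `L`. The per-order files bounded such
weights monomial by monomial (`…DiagRemMonomials.abs_monomial_weight_le`, `…DiagRemFourFourMonomials`); generically the bound propagates
through the two operations:

* `fam_Lpow` — **`L^p`**: if the kernel `D₁(k₁)D₂(k₂)R(αk₁k₂)` satisfies the family bound with `Ψ`, then `D₁(k₁)D₂(k₂)·(L^p·R(αk₁k₂))`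
  satisfies it with `(4Λ)^p·Ψ` (`…DiagGenericRemMonomial.abs_monomial_Lpow_le`);
* `fam_finset_sum` — **finite linear combinations**: kernels `G_x` with envelopes `Ψ_x` (`x ∈ s`) give `Σ_x c_x·G_x` with envelope
  `Σ_x |c_x|·Ψ_x`.

Def-free; theorems only. Helper `--supports stmt-Parity-20007`; closes nothing; K_A, K_B and the Parity summit are NOT proved;
nothing about Landau–Siegel zeros.

## References
* E. Kowalski, P. Michel, J. VanderKam, J. reine angew. Math. 526 (2000), (22)–(28) pp. 12–15 and Prop. 5.1 p. 18.
  [cite: KowalskiMichelVanderKam2000, Prop. 5.1 — derivation (remainder weights of the diagonal, family bounds)]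
-/

noncomputable section

open Finset Real

namespace Summit.Parity.GeneralizedHardyLittlewood.Theorems.MomentsBeyondDiagonal.DiagCorner

open Summit.Parity.GeneralizedHardyLittlewood.Theorems.BeyondDiagonalBeatsQuarter.Corner

/-- **The family bound is stable under `L^p = (2β+ℓ⁺₁+ℓ⁺₂)^p`, at the cost `(4Λ)^p`** (decorations `D₁, D₂` absorbed into the
coefficient sequences). [cite: KowalskiMichelVanderKam2000, Prop. 5.1 — derivation (remainder weights of the diagonal, family bounds)] -/
theorem fam_Lpow (p : ℕ) {a D₁ D₂ : ℕ → ℝ} {R : ℝ → ℝ} {Y α β Λ Ψ : ℝ}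
    (hΛ : 1 ≤ Λ) (hβ : |β| ≤ Λ) (hLY0 : 0 ≤ Real.log Y) (hLY : Real.log Y ≤ Λ) (hΨ : 0 ≤ Ψ)
    (h : ∀ i j : ℕ, 1 ≤ i → 1 ≤ j →
      |∑ k₁ ∈ Icc 1 ⌊Y⌋₊, ∑ k₂ ∈ Icc 1 ⌊Y⌋₊,
          a k₁ * a k₂ * ellp Y k₁ ^ i * ellp Y k₂ ^ j * (D₁ k₁ * D₂ k₂ * R (α * k₁ * k₂))| ≤ Real.log Y ^ (i + j) * Ψ) :
    ∀ i j : ℕ, 1 ≤ i → 1 ≤ j →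
      |∑ k₁ ∈ Icc 1 ⌊Y⌋₊, ∑ k₂ ∈ Icc 1 ⌊Y⌋₊,
          a k₁ * a k₂ * ellp Y k₁ ^ i * ellp Y k₂ ^ j *
            (D₁ k₁ * D₂ k₂ * ((2 * β + ellp Y k₁ + ellp Y k₂) ^ p * R (α * k₁ * k₂)))| ≤
        Real.log Y ^ (i + j) * ((4 * Λ) ^ p * Ψ) := by
  intro i j hi hj
  have hR : ∀ i j : ℕ, 1 ≤ i → 1 ≤ j →
      |∑ k₁ ∈ Icc 1 ⌊Y⌋₊, ∑ k₂ ∈ Icc 1 ⌊Y⌋₊,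
          (fun k ↦ a k * D₁ k) k₁ * (fun k ↦ a k * D₂ k) k₂ * ellp Y k₁ ^ i * ellp Y k₂ ^ j * R (α * k₁ * k₂)| ≤
        Real.log Y ^ (i + j) * Ψ := by
    intro i j hi hj
    refine le_of_eq_of_le (congrArg abs ?_) (h i j hi hj)
    exact Finset.sum_congr rfl fun k₁ _ ↦ Finset.sum_congr rfl fun k₂ _ ↦ by ring
  have key := abs_monomial_Lpow_le p hi hj hΛ hβ hLY0 hLY hΨ hR
  refine le_of_eq_of_le (congrArg abs ?_) (key.trans_eq (by ring))
  exact Finset.sum_congr rfl fun k₁ _ ↦ Finset.sum_congr rfl fun k₂ _ ↦ by ring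

/-- **The family bound is stable under finite linear combinations of kernels** (envelope `Σ_x |c_x|·Ψ_x`).
[cite: KowalskiMichelVanderKam2000, Prop. 5.1 — derivation (remainder weights of the diagonal, family bounds)] -/
theorem fam_finset_sum {ι : Type*} (s : Finset ι) (c : ι → ℝ) (G : ι → ℕ → ℕ → ℝ) (Ψ : ι → ℝ) {a : ℕ → ℝ} {Y : ℝ}
    (h : ∀ x ∈ s, ∀ i j : ℕ, 1 ≤ i → 1 ≤ j →
      |∑ k₁ ∈ Icc 1 ⌊Y⌋₊, ∑ k₂ ∈ Icc 1 ⌊Y⌋₊,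
          a k₁ * a k₂ * ellp Y k₁ ^ i * ellp Y k₂ ^ j * G x k₁ k₂| ≤ Real.log Y ^ (i + j) * Ψ x) :
    ∀ i j : ℕ, 1 ≤ i → 1 ≤ j →
      |∑ k₁ ∈ Icc 1 ⌊Y⌋₊, ∑ k₂ ∈ Icc 1 ⌊Y⌋₊,
          a k₁ * a k₂ * ellp Y k₁ ^ i * ellp Y k₂ ^ j * (∑ x ∈ s, c x * G x k₁ k₂)| ≤
        Real.log Y ^ (i + j) * (∑ x ∈ s, |c x| * Ψ x) := by
  intro i j hi hj
  -- distribute the kernel sum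
  have hdist : ∑ k₁ ∈ Icc 1 ⌊Y⌋₊, ∑ k₂ ∈ Icc 1 ⌊Y⌋₊,
        a k₁ * a k₂ * ellp Y k₁ ^ i * ellp Y k₂ ^ j * (∑ x ∈ s, c x * G x k₁ k₂) =
      ∑ x ∈ s, c x * ∑ k₁ ∈ Icc 1 ⌊Y⌋₊, ∑ k₂ ∈ Icc 1 ⌊Y⌋₊,
        a k₁ * a k₂ * ellp Y k₁ ^ i * ellp Y k₂ ^ j * G x k₁ k₂ := by
    rw [Finset.sum_congr rfl fun k₁ _ ↦ Finset.sum_congr rfl fun k₂ _ ↦ Finset.mul_sum (s := s) ..]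
    rw [Finset.sum_congr rfl fun k₁ _ ↦ Finset.sum_comm, Finset.sum_comm]
    refine Finset.sum_congr rfl fun x _ ↦ ?_
    rw [Finset.mul_sum]
    refine Finset.sum_congr rfl fun k₁ _ ↦ ?_
    rw [Finset.mul_sum]
    refine Finset.sum_congr rfl fun k₂ _ ↦ ?_
    ring
  rw [hdist, Finset.mul_sum]
  refine (Finset.abs_sum_le_sum_abs _ _).trans (Finset.sum_le_sum fun x hx ↦ ?_)
  rw [abs_mul]
  calc |c x| * |∑ k₁ ∈ Icc 1 ⌊Y⌋₊, ∑ k₂ ∈ Icc 1 ⌊Y⌋₊, a k₁ * a k₂ * ellp Y k₁ ^ i * ellp Y k₂ ^ j * G x k₁ k₂|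
      ≤ |c x| * (Real.log Y ^ (i + j) * Ψ x) := mul_le_mul_of_nonneg_left (h x hx i j hi hj) (abs_nonneg _)
    _ = Real.log Y ^ (i + j) * (|c x| * Ψ x) := by ring

end Summit.Parity.GeneralizedHardyLittlewood.Theorems.MomentsBeyondDiagonal.DiagCorner

end
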